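import Literature.Topology.FourManifolds.GaussDiagramsPerturbation
import Literature.Topology.FourManifolds.GaussDiagramsRMoves
import Literature.Topology.FourManifolds.ConnectedSumNormalForm
import Literature.Topology.FourManifolds.KnotsIsotopyProofs
import HarnessLib

/-!
# Pole avoidance: Reidemeister-type statements for Gauss diagrams reduce to knots in the
# southern hemisphere moved by isotopies fixing the northern one

Topic `Literature/Topology/FourManifolds`; a brick of the direction `→` of Reidemeister's theorem
in Gauss-diagram form (the named fact `Knot.reidemeisterR` of `RasmussenWellDefinedR.lean`:
isotopic knots with Gauss diagrams `G, G'` have `G.REquiv G'`; on regular projections this is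
`stub_reidemeisterR` of the summit sketch). Diagrams are read through the FIXED stereographic
chart from the north pole (`GaussDiagrams.lean`), so the geometric content of `→` is an analysis
of the plane curves `t ↦ planeCurve (F_t ∘ K)` along an ambient isotopy `F` — which only makes
sense while the moving knot misses the pole. This file removes that proviso once and for all:

* `Knot.RegularProjection.dilate` — **transport of a regular projection along a homothety of the
  chart**: a knot whose chart curve (`Knot.stereoCurve`, `GaussDiagramsChart.lean`) is `μ • c`,
  `μ > 0`, where `c` is the chart curve of `K`, reads the same Gauss diagram as `K` with the same
  parameters (plane curve and heights scaled by `μ`, velocities by `μ`, the determinants of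
  `sign_eq` by `μ² > 0`); companion of `rotate` / `translate` / `flip` of
  `RegularProjectionTransport.lean`;
* `Knot.exists_isIsotopic_stereoCurve_smul` — **the dilated knot exists and is isotopic to `K`**:
  the family of chart curves `(1 + u (μ - 1)) • c`, `u ∈ [0, 1]`, consists of regular simple closed
  curves, so (`IsRegularClosedCurve.isIsotopic_of_family_Icc`, `CurveFamilyIsotopy.lean`, i.e.
  the isotopy extension theorem) its end knot, whose chart curve is `μ • c`, is ambient isotopic
  to `K` — the same argument as `exists_isIsotopic_stereoCurve_add` of
  `GaussDiagramsPerturbation.lean`, without any smallness;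
* `Knot.exists_isIsotopic_inSouth` — for `μ` small the dilated knot lies in the open southern
  hemisphere `{x₃ < 0}` (`SphereEmbedding.InSouth`: the chart radius `r` and the last coordinate
  are related by `x₃ = (r² - 1)/(r² + 1)`);
* `Knot.RegularProjection.rel_diagram_of_isIsotopic_of_inSouth` — **the reduction**: to prove that
  the diagrams of any two regular projections of isotopic knots stand in a relation `R`, it
  suffices to do so for knots in the open southern hemisphere related by an ambient isotopy all of
  whose stages fix the closed northern hemisphere pointwise (dilate both knots into the south,
  keeping their diagrams; isotopic knots in the south are so related by the southern knots-in-a-ball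
  theorem `Knot.exists_ambientIsotopy_inSouth`, `ConnectedSumNormalForm.lean` / `KnotsInBall.lean`,
  Hirsch (1976), Ch. 8 §1, Thm. 1.3 with Exercise 14); in particular
  (`rel_diagram_of_isIsotopic_of_forall_ne_northPole`) it suffices to treat ambient isotopies along
  which the knot never meets the north pole, and (`rEquiv_diagram_of_isIsotopic_of_forall_ne_northPole`)
  the direction `→` of `Knot.reidemeisterR` on projections reduces to that case.

Everything here is proved; no named facts are introduced.

## References

* K. Reidemeister, *Elementare Begründung der Knotentheorie*, Abh. Math. Sem. Univ. Hamburg 5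
  (1927) 24–32; *Knotentheorie* (1932), Kap. I §1 (diagrams of knots in `ℝ³`). [Reidemeister1932]
* M. W. Hirsch, *Differential Topology*, GTM 33 (1976), Ch. 8 §1, Thm. 1.3 (isotopy extension
  with compact support). [HirschDT1976]
* D. Rolfsen, *Knots and Links* (1976), §3.E (regular projections). [Rolfsen1976]

## Design notes

The reduction is stated for an arbitrary relation `R` on Gauss diagrams because the dilated
projections read *the same* diagrams (`dilate_diagram` is `rfl`); the instance
`SphereEmbedding.isotopyFacts` (`KnotsIsotopyProofs.lean`) supplies symmetry and transitivity of
isotopy. `𝔼 n`, `𝕊 n` are local notation as in `Knots.lean`. No statement of another file is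
modified; no `sorry`; no definition of `Prop` type.
-/

open scoped Manifold ContDiff Topology
open Function Set

noncomputable section

namespace Literature.Topology.FourManifolds

/-- Local notation: `𝔼 n` is the model Euclidean space `EuclideanSpace ℝ (Fin n)`. -/
local notation "𝔼 " n:arg => EuclideanSpace ℝ (Fin n)

/-- Local notation: `𝕊 n` is the unit sphere in `EuclideanSpace ℝ (Fin (n + 1))`. -/
local notation "𝕊 " n:arg => (Metric.sphere (0 : EuclideanSpace ℝ (Fin (n + 1))) 1)

/-! ### Homotheties of the chart -/

/-- The squared chart radius of a dilated point: `r²(μ • y) = μ² r²(y)`. [folklore] -/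
theorem stereoNorthRadSq_smul (μ : ℝ) (y : (ℝ × ℝ) × ℝ) :
    stereoNorthRadSq (μ • y) = μ ^ 2 * stereoNorthRadSq y := by
  simp only [stereoNorthRadSq, Prod.smul_fst, Prod.smul_snd, smul_eq_mul]
  ring

/-- A point of the chart of squared radius `< 1` lies in the open southern hemisphere:
the last coordinate of `stereoNorthInvCoe y` is `(r² - 1)/(r² + 1) < 0`. [folklore] -/
theorem stereoNorthInvCoe_apply_three_neg {y : (ℝ × ℝ) × ℝ} (hy : stereoNorthRadSq y < 1) :
    stereoNorthInvCoe y 3 < 0 := by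
  rw [stereoNorthInvCoe_apply_three]
  exact div_neg_of_neg_of_pos (by linarith) (stereoNorthRadSq_add_one_pos y)

namespace Knot

section SmulChart

variable {K K' : Knot} {μ : ℝ}

/-- The plane curve of a chart-dilate is the dilated plane curve. [folklore] -/
theorem planeCurve_of_stereoCurve_smul (h : K'.stereoCurve = fun t ↦ μ • K.stereoCurve t) (t : ℝ) :
    K'.planeCurve t = μ • K.planeCurve t := by
  have := congrFun h t
  rw [Knot.planeCurve_eq_fst_comp, Function.comp_apply, this]
  rfl

/-- The height function of a chart-dilate is the scaled height function. [folklore] -/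
theorem heightCurve_of_stereoCurve_smul (h : K'.stereoCurve = fun t ↦ μ • K.stereoCurve t) (t : ℝ) :
    K'.heightCurve t = μ * K.heightCurve t := by
  have := congrFun h t
  rw [Knot.heightCurve_eq_snd_comp, Function.comp_apply, this]
  rfl

/-- The velocity of the plane curve of a chart-dilate is the scaled velocity. [folklore] -/
theorem deriv_planeCurve_of_stereoCurve_smul (hK : ∀ x, K x ≠ northPole)
    (h : K'.stereoCurve = fun t ↦ μ • K.stereoCurve t) (t : ℝ) :
    deriv K'.planeCurve t = μ • deriv K.planeCurve t := by
  have e : K'.planeCurve = μ • K.planeCurve := funext (planeCurve_of_stereoCurve_smul h)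
  rw [e, deriv_const_smul _ ((K.contDiff_planeCurve hK).differentiable (by simp) t)]

end SmulChart

namespace RegularProjection

variable {K : Knot} (P : K.RegularProjection) {K' : Knot} {μ : ℝ}

/-- **Transport of a regular projection along a homothety of the chart.** If the chart curve of
`K'` (stereographic chart from the north pole) is `μ • c`, `μ > 0`, where `c` is that of `K`, then
`K'` reads, with the same parameters, the same Gauss diagram as `K`: the plane curve is dilated
(same double points, velocities scaled by `μ`, determinants by `μ² > 0`, same signs) and all
heights are scaled by `μ > 0` (same over/under data). Rolfsen (1976), §3.E.
[cite: Rolfsen1976, §3.E] -/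
def dilate (hK' : northPole ∉ range K') (hμ : 0 < μ)
    (h : K'.stereoCurve = fun t ↦ μ • K.stereoCurve t) : K'.RegularProjection where
  diagram := P.diagram
  θ := P.θ
  strictMono := P.strictMono
  lt_add_two_pi := P.lt_add_two_pi
  northPole_notMem := hK'
  deriv_ne_zero t := by
    rw [deriv_planeCurve_of_stereoCurve_smul (fun x hx ↦ P.northPole_notMem ⟨x, hx⟩) h]
    exact smul_ne_zero hμ.ne' (P.deriv_ne_zero t)
  double i := by
    rw [planeCurve_of_stereoCurve_smul h, planeCurve_of_stereoCurve_smul h, P.double i]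
  eq_or_crossing s t hst := by
    rw [planeCurve_of_stereoCurve_smul h, planeCurve_of_stereoCurve_smul h] at hst
    exact P.eq_or_crossing s t (smul_right_injective _ hμ.ne' hst)
  heightCurve_lt i := by
    rw [heightCurve_of_stereoCurve_smul h, heightCurve_of_stereoCurve_smul h]
    exact mul_lt_mul_of_pos_left (P.heightCurve_lt i) hμ
  sign_eq i := by
    rw [deriv_planeCurve_of_stereoCurve_smul (fun x hx ↦ P.northPole_notMem ⟨x, hx⟩) h,
      deriv_planeCurve_of_stereoCurve_smul (fun x hx ↦ P.northPole_notMem ⟨x, hx⟩) h, P.sign_eq i,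
      Matrix.det_fin_two_of, Matrix.det_fin_two_of]
    simp only [Prod.smul_fst, Prod.smul_snd, smul_eq_mul]
    rw [show μ * (deriv K.planeCurve (P.θ (P.diagram.overPos i))).1 *
          (μ * (deriv K.planeCurve (P.θ (P.diagram.underPos i))).2) -
          μ * (deriv K.planeCurve (P.θ (P.diagram.overPos i))).2 *
          (μ * (deriv K.planeCurve (P.θ (P.diagram.underPos i))).1)
        = (μ * μ) * ((deriv K.planeCurve (P.θ (P.diagram.overPos i))).1 *
          (deriv K.planeCurve (P.θ (P.diagram.underPos i))).2 -
          (deriv K.planeCurve (P.θ (P.diagram.overPos i))).2 *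
          (deriv K.planeCurve (P.θ (P.diagram.underPos i))).1) by ring,
      sign_mul, sign_pos (mul_pos hμ hμ), one_mul]

/-- The dilated projection reads the same diagram. [folklore] -/
@[simp] theorem dilate_diagram (hK' : northPole ∉ range K') (hμ : 0 < μ)
    (h : K'.stereoCurve = fun t ↦ μ • K.stereoCurve t) : (P.dilate hK' hμ h).diagram = P.diagram :=
  rfl

/-- The dilated projection has the same parameters. [folklore] -/
@[simp] theorem dilate_θ (hK' : northPole ∉ range K') (hμ : 0 < μ)
    (h : K'.stereoCurve = fun t ↦ μ • K.stereoCurve t) : (P.dilate hK' hμ h).θ = P.θ :=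
  rfl

end RegularProjection

/-! ### The dilated knot exists and is isotopic to the knot -/

section Dilate

variable {K : Knot} {μ : ℝ}

/-- The factor of the dilation family `u ↦ 1 + u (μ - 1)` is positive on `[0, 1]` (it runs from
`1` to `μ > 0`). [folklore] -/
theorem dilateFactor_pos (hμ : 0 < μ) {u : ℝ} (hu : u ∈ Icc (0 : ℝ) 1) : 0 < 1 + u * (μ - 1) := by
  rcases le_or_gt μ 1 with h | h
  · nlinarith [hu.1, hu.2]
  · nlinarith [hu.1, hu.2]

/-- The straight-line family towards `(μ - 1) • c` is the dilation family `(1 + u (μ - 1)) • c`.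
[folklore] -/
theorem pertFamily_smul (u : ℝ) :
    pertFamily K (fun θ ↦ (μ - 1) • K.stereoCurve θ) u
      = fun θ ↦ (1 + u * (μ - 1)) • K.stereoCurve θ := by
  funext θ
  simp only [pertFamily, smul_smul, add_smul, one_smul]

/-- All stages `u ∈ [0, 1]` of the dilation family are regular and injective modulo `2π`.
[folklore] -/
theorem pertFamily_smul_regular (hK : ∀ x, K x ≠ northPole) (hμ : 0 < μ) {u : ℝ}
    (hu : u ∈ Icc (0 : ℝ) 1) :
    (∀ θ, deriv (pertFamily K (fun θ ↦ (μ - 1) • K.stereoCurve θ) u) θ ≠ 0) ∧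
      ∀ s₁ s₂, pertFamily K (fun θ ↦ (μ - 1) • K.stereoCurve θ) u s₁
          = pertFamily K (fun θ ↦ (μ - 1) • K.stereoCurve θ) u s₂ →
        circlePoint s₁ = circlePoint s₂ := by
  have ha := dilateFactor_pos hμ hu
  rw [pertFamily_smul]
  refine ⟨fun θ ↦ ?_, fun s₁ s₂ hs ↦ ?_⟩
  · have e : (fun θ ↦ (1 + u * (μ - 1)) • K.stereoCurve θ) = (1 + u * (μ - 1)) • K.stereoCurve :=
      rfl
    rw [e, deriv_const_smul _ (differentiable_stereoCurve hK θ)]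
    exact smul_ne_zero ha.ne' (deriv_stereoCurve_ne_zero hK θ)
  · exact (stereoCurve_eq_iff hK).1 (smul_right_injective _ ha.ne' hs)

/-- **The dilated knot.** For a knot `K` missing the north pole and `μ > 0` there is a knot `K'`,
ambient isotopic to `K`, missing the north pole, whose chart curve is `μ • stereoCurve K` (the
dilation family of regular simple closed curves and the isotopy extension theorem, as in
`exists_isIsotopic_stereoCurve_add`). Hirsch (1976), Ch. 8 §1, Thm. 1.3.
[cite: HirschDT1976, Ch. 8 §1, Thm. 1.3] -/
theorem exists_isIsotopic_stereoCurve_smul (hK : ∀ x, K x ≠ northPole) (hμ : 0 < μ) :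
    ∃ K' : Knot, K.IsIsotopic K' ∧ (∀ x, K' x ≠ northPole) ∧
      K'.stereoCurve = fun θ ↦ μ • K.stereoCurve θ := by
  set P : ℝ → (ℝ × ℝ) × ℝ := fun θ ↦ (μ - 1) • K.stereoCurve θ with hP_def
  have hP : ContDiff ℝ ∞ P := (contDiff_stereoCurve hK).const_smul _
  have hPper : Periodic P (2 * Real.pi) := fun θ ↦ by
    simp only [hP_def, K.periodic_stereoCurve θ]
  have hallP : ∀ u ∈ Icc (0 : ℝ) 1, (∀ θ, deriv (pertFamily K P u) θ ≠ 0) ∧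
      ∀ s₁ s₂, pertFamily K P u s₁ = pertFamily K P u s₂ → circlePoint s₁ = circlePoint s₂ :=
    fun u hu ↦ pertFamily_smul_regular hK hμ hu
  -- the family of regular simple closed curves on the sphere, `u ∈ [0, 1]`
  have hcurve : ∀ u ∈ Icc (0 : ℝ) 1, IsRegularClosedCurve (pertCurveFamily K P u) := fun u hu ↦
    isRegularClosedCurve_pertCurveFamily hK hP hPper (hallP u hu).1
  have hinj : ∀ u ∈ Icc (0 : ℝ) 1, ∀ s t, pertCurveFamily K P u s = pertCurveFamily K P u t →
      circlePoint s = circlePoint t := fun u hu ↦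
    stereoNorthInvCoe_comp_eq_imp (e := pertFamily K P u) (hallP u hu).2
  have hiso := IsRegularClosedCurve.isIsotopic_of_family_Icc
    (contDiff_uncurry_pertCurveFamily hK hP) hcurve hinj
  -- the end stage
  have hreg1 : ∀ θ, deriv (fun θ ↦ K.stereoCurve θ + P θ) θ ≠ 0 := by
    have := (hallP 1 ⟨zero_le_one, le_rfl⟩).1
    rwa [pertFamily_one] at this
  have hinj1 : ∀ s t, K.stereoCurve s + P s = K.stereoCurve t + P t →
      circlePoint s = circlePoint t := by
    have := (hallP 1 ⟨zero_le_one, le_rfl⟩).2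
    rwa [pertFamily_one] at this
  have hend : (fun θ ↦ K.stereoCurve θ + P θ) = fun θ ↦ μ • K.stereoCurve θ := by
    funext θ
    simp only [hP_def]
    rw [sub_smul, one_smul, add_sub_cancel]
  refine ⟨pertKnot hK hP hPper hreg1 hinj1, ?_, pertKnot_ne_northPole hK hP hPper hreg1 hinj1,
    (stereoCurve_pertKnot hK hP hPper hreg1 hinj1).trans hend⟩
  -- identify the endpoints of the family isotopy
  rw [IsRegularClosedCurve.toKnot_congr (hcurve 0 ⟨le_rfl, zero_le_one⟩)
      (SphereEmbedding.isRegularClosedCurve_curve K) (hinj 0 ⟨le_rfl, zero_le_one⟩)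
      (circlePoint_eq_of_curve_eq K) (pertCurveFamily_zero hK),
    SphereEmbedding.toKnot_curve,
    IsRegularClosedCurve.toKnot_congr (hcurve 1 ⟨zero_le_one, le_rfl⟩)
      (isRegularClosedCurve_stereoNorthInvCoe_comp ((contDiff_stereoCurve hK).add hP)
        (fun θ ↦ by simp only [K.periodic_stereoCurve θ, hPper θ]) hreg1)
      (hinj 1 ⟨zero_le_one, le_rfl⟩) (stereoNorthInvCoe_comp_eq_imp hinj1)
      pertCurveFamily_one] at hiso
  exact hiso

/-- The squared chart radius of a knot missing the north pole is bounded (a continuous periodic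
function). [folklore] -/
theorem exists_stereoNorthRadSq_stereoCurve_le (hK : ∀ x, K x ≠ northPole) :
    ∃ M : ℝ, ∀ θ, stereoNorthRadSq (K.stereoCurve θ) ≤ M := by
  have hcont : Continuous fun θ ↦ stereoNorthRadSq (K.stereoCurve θ) :=
    contDiff_stereoNorthRadSq.continuous.comp (continuous_stereoCurve hK)
  have hper : Periodic (fun θ ↦ stereoNorthRadSq (K.stereoCurve θ)) (2 * Real.pi) := fun θ ↦ by
    simp only [K.periodic_stereoCurve θ]
  obtain ⟨M, hM⟩ := (isCompact_uIcc.image hcont).bddAbove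
  refine ⟨M, fun θ ↦ hM ?_⟩
  rw [hper.image_uIcc Real.two_pi_pos.ne' 0]
  exact mem_range_self θ

/-- A knot missing the north pole whose chart curve has squared radius `< 1` everywhere lies in
the open southern hemisphere. [folklore] -/
theorem inSouth_of_stereoNorthRadSq_lt_one (hK : ∀ x, K x ≠ northPole)
    (h : ∀ θ, stereoNorthRadSq (K.stereoCurve θ) < 1) : SphereEmbedding.InSouth K := by
  intro x
  obtain ⟨θ, rfl⟩ := circlePoint_surjective x
  have e : ((K (circlePoint θ) : 𝕊 3) : 𝔼 4) = stereoNorthInvCoe (K.stereoCurve θ) :=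
    (stereoNorthInvCoe_stereoCurve hK θ).symm
  rw [show (Fin.last 3 : Fin 4) = 3 from rfl, e]
  exact stereoNorthInvCoe_apply_three_neg (h θ)

/-- **Every knot missing the north pole is isotopic to a chart-dilate of itself lying in the open
southern hemisphere** (dilate by `μ = 1/(M + 2)`, `M` a bound for the squared chart radius).
[cite: HirschDT1976, Ch. 8 §1, Thm. 1.3] -/
theorem exists_isIsotopic_inSouth (hK : ∀ x, K x ≠ northPole) :
    ∃ (K' : Knot) (μ : ℝ), 0 < μ ∧ K.IsIsotopic K' ∧ (∀ x, K' x ≠ northPole) ∧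
      SphereEmbedding.InSouth K' ∧ K'.stereoCurve = fun θ ↦ μ • K.stereoCurve θ := by
  obtain ⟨M, hM⟩ := exists_stereoNorthRadSq_stereoCurve_le hK
  have hM0 : 0 ≤ M := (stereoNorthRadSq_nonneg _).trans (hM 0)
  set μ : ℝ := 1 / (M + 2) with hμ_def
  have hμ : 0 < μ := by rw [hμ_def]; positivity
  obtain ⟨K', hKK', hK', hc⟩ := exists_isIsotopic_stereoCurve_smul hK hμ
  refine ⟨K', μ, hμ, hKK', hK', inSouth_of_stereoNorthRadSq_lt_one hK' fun θ ↦ ?_, hc⟩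
  rw [hc, stereoNorthRadSq_smul]
  have h1 : μ ^ 2 * stereoNorthRadSq (K.stereoCurve θ) ≤ μ ^ 2 * M :=
    mul_le_mul_of_nonneg_left (hM θ) (sq_nonneg μ)
  have h2 : μ ^ 2 * M < 1 := by
    rw [hμ_def, div_pow, one_pow, div_mul_eq_mul_div, one_mul, div_lt_one (by positivity)]
    nlinarith
  exact h1.trans_lt h2

end Dilate

/-! ### The reduction -/

namespace RegularProjection

/-- **Reduction to the southern hemisphere.** Let `R` be any relation on Gauss diagrams. If the
diagrams of any two regular projections of knots `K, K'` lying in the open southern hemisphere and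
related by an ambient isotopy all of whose stages fix the closed northern hemisphere pointwise stand
in the relation `R`, then so do the diagrams of any two regular projections of any two isotopic
knots: dilate both knots into the south (`exists_isIsotopic_inSouth`; the dilated knots read the
same diagrams, `dilate`), and join the dilated knots, which are isotopic, by the southern
knots-in-a-ball theorem `Knot.exists_ambientIsotopy_inSouth`. Hirsch (1976), Ch. 8 §1, Thm. 1.3
with Exercise 14. [cite: HirschDT1976, Ch. 8 §1, Thm. 1.3] -/
theorem rel_diagram_of_isIsotopic_of_inSouth (R : GaussDiagram → GaussDiagram → Prop)
    (H : ∀ {K K' : Knot} (P : K.RegularProjection) (P' : K'.RegularProjection)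
      (G : AmbientIsotopy (𝓡 3) (𝕊 3)), SphereEmbedding.InSouth K → SphereEmbedding.InSouth K' →
      (∀ t, ∀ x : 𝕊 3, 0 ≤ (x : 𝔼 4) (Fin.last 3) → G.toFun t x = x) → G.toFun 1 ∘ ⇑K = ⇑K' →
      R P.diagram P'.diagram)
    {K K' : Knot} (P : K.RegularProjection) (P' : K'.RegularProjection) (h : K.IsIsotopic K') :
    R P.diagram P'.diagram := by
  have hK : ∀ x, K x ≠ northPole := fun x hx ↦ P.northPole_notMem ⟨x, hx⟩
  have hK' : ∀ x, K' x ≠ northPole := fun x hx ↦ P'.northPole_notMem ⟨x, hx⟩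
  obtain ⟨K₁, μ, hμ, h₁, hK₁, hS₁, hc₁⟩ := exists_isIsotopic_inSouth hK
  obtain ⟨K'₁, μ', hμ', h'₁, hK'₁, hS'₁, hc'₁⟩ := exists_isIsotopic_inSouth hK'
  have hiso : K₁.IsIsotopic K'₁ :=
    SphereEmbedding.IsotopyFacts.trans (SphereEmbedding.IsotopyFacts.symm h₁)
      (SphereEmbedding.IsotopyFacts.trans h h'₁)
  obtain ⟨G, hGfix, hG1⟩ := exists_ambientIsotopy_inSouth hiso hS₁ hS'₁
  exact H (P.dilate (fun ⟨x, hx⟩ ↦ hK₁ x hx) hμ hc₁) (P'.dilate (fun ⟨x, hx⟩ ↦ hK'₁ x hx) hμ' hc'₁)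
    G hS₁ hS'₁ hGfix hG1

/-- **Reduction to isotopies missing the pole.** Let `R` be any relation on Gauss diagrams. If the
diagrams of any two regular projections of knots `K, K'` joined by an ambient isotopy `G`
(`G 1 ∘ K = K'`) along which the knot never passes through the north pole stand in the relation
`R`, then so do the diagrams of any two regular projections of any two isotopic knots (an isotopy
fixing the closed northern hemisphere keeps a southern knot off the pole).
[cite: HirschDT1976, Ch. 8 §1, Thm. 1.3] -/
theorem rel_diagram_of_isIsotopic_of_forall_ne_northPole (R : GaussDiagram → GaussDiagram → Prop)
    (H : ∀ {K K' : Knot} (P : K.RegularProjection) (P' : K'.RegularProjection)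
      (G : AmbientIsotopy (𝓡 3) (𝕊 3)), (∀ t, ∀ x : 𝕊 1, G.toFun t (K x) ≠ northPole) →
      G.toFun 1 ∘ ⇑K = ⇑K' → R P.diagram P'.diagram)
    {K K' : Knot} (P : K.RegularProjection) (P' : K'.RegularProjection) (h : K.IsIsotopic K') :
    R P.diagram P'.diagram := by
  refine rel_diagram_of_isIsotopic_of_inSouth R (fun P₁ P₁' G hS _ hfix h1 ↦ H P₁ P₁' G ?_ h1) P P' h
  intro t x hx
  -- the last coordinate of the north pole (`KnotsInBall.northPole_apply_last`, for the copy of the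
  -- pole local to `KnotsInBall.lean`)
  have hN1 : ((northPole : 𝕊 3) : 𝔼 4) (Fin.last 3) = 1 := by
    rw [coe_northPole, show (Fin.last 3 : Fin 4) = 3 from rfl]
    simp
  have hN := hfix t northPole (by rw [hN1]; exact zero_le_one)
  have heq : _ = northPole := (G.bijective t).1 (hx.trans hN.symm)
  have hlt := hS x
  rw [heq, hN1] at hlt
  exact absurd hlt (by norm_num)

/-- **The direction `→` of Reidemeister's theorem for Gauss diagrams (`Knot.reidemeisterR`,
`RasmussenWellDefinedR.lean`), read on projections, reduces to isotopies missing the pole**: if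
the diagrams of regular projections of knots joined by an ambient isotopy along which the knot
never meets the north pole are `REquiv`-alent, then the diagrams of any two regular projections of
isotopic knots are `REquiv`-alent. (What remains is Reidemeister's theorem proper, in the chart:
Reidemeister (1927); not proved in the tree.) [cite: Reidemeister1932, Kap. I §1] -/
theorem rEquiv_diagram_of_isIsotopic_of_forall_ne_northPole
    (H : ∀ {K K' : Knot} (P : K.RegularProjection) (P' : K'.RegularProjection)
      (G : AmbientIsotopy (𝓡 3) (𝕊 3)), (∀ t, ∀ x : 𝕊 1, G.toFun t (K x) ≠ northPole) →
      G.toFun 1 ∘ ⇑K = ⇑K' → P.diagram.REquiv P'.diagram)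
    {K K' : Knot} (P : K.RegularProjection) (P' : K'.RegularProjection) (h : K.IsIsotopic K') :
    P.diagram.REquiv P'.diagram :=
  rel_diagram_of_isIsotopic_of_forall_ne_northPole GaussDiagram.REquiv H P P' h

end RegularProjection

/-- **Isotopy invariance of `HasGaussDiagram` up to dilation**: a knot missing the north pole
with a regular projection reading `G` is isotopic to a knot in the open southern hemisphere with a
regular projection reading `G`. [cite: HirschDT1976, Ch. 8 §1, Thm. 1.3] -/
theorem HasGaussDiagram.exists_isIsotopic_inSouth {K : Knot} {G : GaussDiagram}
    (h : K.HasGaussDiagram G) :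
    ∃ K' : Knot, K.IsIsotopic K' ∧ SphereEmbedding.InSouth K' ∧ K'.HasGaussDiagram G := by
  obtain ⟨P, rfl⟩ := h
  obtain ⟨K', μ, hμ, hKK', hK', hS, hc⟩ :=
    Knot.exists_isIsotopic_inSouth (K := K) fun x hx ↦ P.northPole_notMem ⟨x, hx⟩
  exact ⟨K', hKK', hS, P.dilate (fun ⟨x, hx⟩ ↦ hK' x hx) hμ hc, rfl⟩

end Knot

end Literature.Topology.FourManifolds
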